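import Summits.ResolutionOfSingularities.ResolutionOfSingularities.Theorems.HilbertSamuelEliminationSigmaMaxModificationsCorridor3StrictTransformKernel
import HarnessLib

/-!
# [OURS · L1 W4.5(b) · EL♮(3)] rung TOWER supplier — THE CONE-ROUND BRICK: blowing up the Cartier cut `E ∩ V(𝒦)` of a closed
# subscheme `V(𝒦)` leaves `V(𝒦)` unchanged (its strict transform IS `V(𝒦)`), and the exceptional divisor again cuts it in a
# Cartier divisor — so cone-witnessed rounds ITERATE

Crux chain w45b (cell `res-hironaka`, slot W4.5(b)), working crux **EL♮** = stmt-ResolutionOfSingularities-20038, child **EL♮(3)** =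
stmt-ResolutionOfSingularities-20148, route EquisingularLift, line `sections`, rung TOWER (`…NatTowerDefs` p541504, `ConeWitness` rounds;
TOWER-INST p542565, res-L1-w45b-lead-2). Object «CONE-ROUND BRICK» named by res-L1-w45b-plan-1 2026-08-27T15:28:07Z, clause shape by
res-L1-w45b-lead-2 15:36:16Z («pure blow-up geometry: any scheme, no `O`, no Member»), hand res-D-pv-051. HONEST FRAMING: OURS; NOT a
statement of any manuscript; AI-written, weaker than expert review. No `sorry`; standard axioms. DEF-FREE.
`--supports stmt-ResolutionOfSingularities-20148 --as helper`.

DATA. `X` locally Noetherian, ideal sheaves `𝓔 𝒦` on `X` with `hE𝒦 : IsEffectiveCartier (𝓔.comap 𝒦.subschemeι)` («the exceptional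
divisor restricts to an effective Cartier divisor on the cone `V(𝒦)`»), centre `C := 𝓔 ⊔ 𝒦` (`V(C) = E ∩ V(𝒦)` scheme-theoretically),
`τ : X' → X` a blow-up along `C`; outputs `𝓔' := C.comap τ` (the new exceptional divisor) and `𝒦' := strictTransformIdeal τ C 𝒦`.

* (imported) `…Corridor3.Helpers.isEffectiveCartier_comap_subschemeι_strictTransformIdeal` — for ANY blow-up and ANY `K`: the
  exceptional divisor restricts to an effective Cartier divisor on the strict transform `V(St K)` (the strict-transform ideal
  `⋃ₙ (τ^*K : 𝓘(D)ⁿ)` is `𝓘(D)`-saturated). This is clause (2) «the hypothesis reproduces» — unconditionally.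
* `exists_hom_subscheme_strictTransformIdeal_of_idealSheaf` — the morphism `V(St K) → V(K)` over `τ` (ideal-sheaf form of the
  Corridor-3 lemma, which is stated for a closed immersion `i : Y ↪ X` and `i.ker`).
* `isBlowup_subscheme_strictTransformIdeal_of_idealSheaf` — for ANY `K`, EVERY morphism `V(St K) → V(K)` over `τ` is a blow-up of
  `V(K)` along `C|_{V(K)}` (ideal-sheaf form of Corridor-3's `isBlowup_subscheme_strictTransformIdeal`, GW I 13.91 (1) / 13.96 (2)).
* **`isIso_subscheme_strictTransformIdeal_of_isEffectiveCartier`** — clause (1): if `C|_{V(K)}` is already an effective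
  Cartier divisor, that blow-up is an ISOMORPHISM `V(St K) ≅ V(K)` over `τ` (`IsBlowup.isIso`).
* **`coneRound`** — THE BRICK in lead-2's letters: `C := 𝓔 ⊔ 𝒦`, `C|_{V(𝒦)} = 𝓔|_{V(𝒦)}`; (1) an iso `e : V(𝒦') ≅ V(𝒦)` with
  `e.hom ≫ 𝒦.subschemeι = 𝒦'.subschemeι ≫ τ`; (2) `IsEffectiveCartier (𝓔'.comap 𝒦'.subschemeι)`; (3′) the new cut in the old letters:
  `(𝓔' ⊔ 𝒦').comap 𝒦'.subschemeι = ((𝓔 ⊔ 𝒦).comap 𝒦.subschemeι).comap e.hom` — i.e. under `e`, `V(𝓔' ⊔ 𝒦') ⊆ V(𝒦')` IS the old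
  centre `V(𝓔 ⊔ 𝒦) ⊆ V(𝒦)`; the scheme isomorphism `V(𝓔' ⊔ 𝒦') ≅ V(𝓔 ⊔ 𝒦)` over `τ` and its IsRegular / Flat transports (lead-2's
  (3)/(3a)/(3b)) are the sub-subscheme repackaging of (3′), left to part 2 with the trace clause (4).

References: Görtz–Wedhorn I, Prop. 13.91 (1), (13.19) [GortzWedhorn2020]; BGMW 2011 §4 Remark (3) [BierstoneGrigorievMilmanWlodarczyk2011];
tree `…Corridor3StrictTransformKernel.lean` (saturation, strict transform = blow-up, in the `i.ker` currency), `RestrictionPropertyCartier.lean`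
(the controlled-transform version), `IsBlowup.isIso`.
-/

set_option linter.dupNamespace false -- mandated namespace `Summit.<Summit>.<Problem>` of this single-conjunct summit

noncomputable section

open CategoryTheory CategoryTheory.Limits AlgebraicGeometry TopologicalSpace
open Literature.AlgebraicGeometry.Resolution
open AlgebraicGeometry.Scheme.IdealSheafData

universe u

namespace Summit.ResolutionOfSingularities.ResolutionOfSingularities.Cruxes.EquisingularLiftNat.Sections

/-! ## Saturation (imported): the exceptional divisor is Cartier on every strict transform

The key unconditional fact `isEffectiveCartier_comap_subschemeι_strictTransformIdeal` — for ANY blow-up `π` along `C` and ANY `K`,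
`𝓘(D)` restricts to an effective Cartier divisor on `V(strictTransformIdeal π C K)` (saturation) — is the W4.2 campaign's
`…SigmaMaxModificationsCorridor3.Helpers` lemma (`…Corridor3StrictTransformKernel.lean`), reused here by import. -/


/-! ## The strict transform of `V(K)`, `K ≤ C`, is a blow-up of `V(K)` along `C|_{V(K)}` -/

section StrictTransform

variable {X X' : Scheme.{u}} [IsLocallyNoetherian X] {π : X' ⟶ X} {C : X.IdealSheafData}

omit [IsLocallyNoetherian X] in
/-- **The morphism `V(St K) → V(K)` over the blow-up exists** (`τ^*K ⊆ St K`). [folklore] -/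
theorem exists_hom_subscheme_strictTransformIdeal_of_idealSheaf (π : X' ⟶ X) (C K : X.IdealSheafData) :
    ∃ πS : (strictTransformIdeal π C K).subscheme ⟶ K.subscheme,
      πS ≫ K.subschemeι = (strictTransformIdeal π C K).subschemeι ≫ π := by
  have hker : K.subschemeι.ker ≤ ((strictTransformIdeal π C K).subschemeι ≫ π).ker := by
    rw [Scheme.IdealSheafData.ker_subschemeι, le_ker_iff_comap_eq_bot, Scheme.IdealSheafData.comap_comp]
    refine le_bot_iff.mp ?_
    calc (K.comap π).comap (strictTransformIdeal π C K).subschemeι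
        ≤ (strictTransformIdeal π C K).comap (strictTransformIdeal π C K).subschemeι :=
          Scheme.IdealSheafData.comap_mono (f := (strictTransformIdeal π C K).subschemeι)
            ((comap_le_controlledTransform π C K 0).trans (controlledTransform_le_strictTransformIdeal π C K 0))
      _ = ⊥ := comap_subschemeι_self _
  exact ⟨IsClosedImmersion.lift _ _ hker, IsClosedImmersion.lift_fac _ _ hker⟩

/-- **The restriction property for the strict transform.** For a blow-up `π : X' → X` along `C` and ANY `K`, EVERY morphism
`πS : V(St K) → V(K)` over `π` is a blow-up of `V(K)` along `C|_{V(K)}`: the exceptional divisor is Cartier on `V(St K)` by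
saturation, and a test morphism `W → X'` whose pulled-back exceptional divisor is Cartier kills every `(τ^*K : 𝓘(D)ⁿ)`.
[cite: GortzWedhorn2020, Prop. 13.91 (1) p. 414] -/
theorem isBlowup_subscheme_strictTransformIdeal_of_idealSheaf (hπ : IsBlowup π C) {K : X.IdealSheafData}
    (πS : (strictTransformIdeal π C K).subscheme ⟶ K.subscheme)
    (hπS : πS ≫ K.subschemeι = (strictTransformIdeal π C K).subschemeι ≫ π) :
    IsBlowup πS (C.comap K.subschemeι) := by
  -- adapted from `IsBlowup.isBlowup_subscheme_controlledTransform_of_isEffectiveCartier` (RestrictionPropertyCartier)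
  haveI : IsProper π := hπ.isProper
  haveI : IsLocallyNoetherian X' := LocallyOfFiniteType.isLocallyNoetherian π
  constructor
  · rw [← Scheme.IdealSheafData.comap_comp, hπS, Scheme.IdealSheafData.comap_comp]
    exact Summit.ResolutionOfSingularities.ResolutionOfSingularities.Theorems.SigmaMaxModificationsCorridor3.Helpers.isEffectiveCartier_comap_subschemeι_strictTransformIdeal hπ K
  · intro W f hf
    have hf' : IsEffectiveCartier (C.comap (f ≫ K.subschemeι)) := by
      rwa [Scheme.IdealSheafData.comap_comp]
    obtain ⟨g, hg, hgu⟩ := hπ.universal (f ≫ K.subschemeι) hf'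
    have hDg : IsEffectiveCartier ((C.comap π).comap g) := by
      rwa [← Scheme.IdealSheafData.comap_comp, hg]
    -- every level of the saturation dies on `W`
    have hlevel : ∀ n : ℕ, (colon (K.comap π) ((C.comap π) ^ n)).comap g = ⊥ := by
      intro n
      have hprod : ((C.comap π).comap g) ^ n * (colon (K.comap π) ((C.comap π) ^ n)).comap g = ⊥ := by
        rw [← comap_pow, ← comap_mul]
        have h := mul_colon_le (K.comap π) ((C.comap π) ^ n)
        refine le_bot_iff.mp ?_
        calc ((C.comap π) ^ n * colon (K.comap π) ((C.comap π) ^ n)).comap g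
            ≤ (K.comap π).comap g := Scheme.IdealSheafData.comap_mono (f := g) h
          _ = ⊥ := by
            rw [← Scheme.IdealSheafData.comap_comp, hg, Scheme.IdealSheafData.comap_comp, comap_subschemeι_self,
              Scheme.IdealSheafData.comap_bot]
      exact Summit.ResolutionOfSingularities.ResolutionOfSingularities.Theorems.SigmaMaxModificationsCorridor3.Helpers.eq_bot_of_pow_mul_eq_bot_of_isEffectiveCartier hDg n hprod
    have hle : (strictTransformIdeal π C K).subschemeι.ker ≤ g.ker := by
      rw [Scheme.IdealSheafData.ker_subschemeι, strictTransformIdeal]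
      refine iSup_le fun n => ?_
      rw [le_ker_iff_comap_eq_bot]
      exact hlevel n
    refine ⟨IsClosedImmersion.lift (strictTransformIdeal π C K).subschemeι g hle, ?_, ?_⟩
    · show IsClosedImmersion.lift (strictTransformIdeal π C K).subschemeι g hle ≫ πS = f
      rw [← cancel_mono K.subschemeι, Category.assoc, hπS, IsClosedImmersion.lift_fac_assoc, hg]
    · intro g' hg'
      change g' ≫ πS = f at hg'
      rw [← cancel_mono (strictTransformIdeal π C K).subschemeι, IsClosedImmersion.lift_fac]
      apply hgu
      show (g' ≫ (strictTransformIdeal π C K).subschemeι) ≫ π = f ≫ K.subschemeι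
      rw [Category.assoc, ← hπS, ← Category.assoc, hg']

/-- **Clause (1): if `C|_{V(K)}` is an effective Cartier divisor on `V(K)`, the strict transform of `V(K)` IS `V(K)`** — every
morphism `V(St K) → V(K)` over the blow-up is an isomorphism (a blow-up along an effective Cartier divisor is an iso).
[cite: GortzWedhorn2020, (13.19) p. 413] -/
theorem isIso_subscheme_strictTransformIdeal_of_isEffectiveCartier (hπ : IsBlowup π C) {K : X.IdealSheafData}
    (hCK : IsEffectiveCartier (C.comap K.subschemeι))
    (πS : (strictTransformIdeal π C K).subscheme ⟶ K.subscheme)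
    (hπS : πS ≫ K.subschemeι = (strictTransformIdeal π C K).subschemeι ≫ π) : IsIso πS :=
  (isBlowup_subscheme_strictTransformIdeal_of_idealSheaf hπ πS hπS).isIso hCK

end StrictTransform

/-! ## The cone-round brick -/

section ConeRound

variable {X X' : Scheme.{u}} [IsLocallyNoetherian X] (𝓔 𝒦 : X.IdealSheafData) {τ : X' ⟶ X}

omit [IsLocallyNoetherian X] in
/-- On `V(𝒦)` the centre `𝓔 ⊔ 𝒦` restricts to `𝓔|_{V(𝒦)}`. [folklore] -/
theorem comap_sup_subschemeι_self : (𝓔 ⊔ 𝒦).comap 𝒦.subschemeι = 𝓔.comap 𝒦.subschemeι := by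
  rw [Scheme.IdealSheafData.comap_sup, comap_subschemeι_self, sup_bot_eq]

/-- **THE CONE-ROUND BRICK** (res-L1-w45b-lead-2's clause shape 2026-08-27T15:36:16Z, clauses (1), (2), (3′)). Let `X` be locally
Noetherian, `𝓔 𝒦` ideal sheaves with `𝓔|_{V(𝒦)}` an effective Cartier divisor on the cone `V(𝒦)`, `C := 𝓔 ⊔ 𝒦` and `τ : X' → X` a
blow-up along `C`; put `𝓔' := C.comap τ`, `𝒦' := strictTransformIdeal τ C 𝒦`. Then: (1) there is an ISOMORPHISM `e : V(𝒦') ≅ V(𝒦)`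
over `τ` — the strict transform of the cone is the cone; (2) `𝓔'|_{V(𝒦')}` is again an effective Cartier divisor — the hypothesis
reproduces, so the rounds iterate with `C' := 𝓔' ⊔ 𝒦'`; (3′) under `e` the new cut `V(𝓔' ⊔ 𝒦') ⊆ V(𝒦')` is the old centre
`V(𝓔 ⊔ 𝒦) ⊆ V(𝒦)`: `(𝓔' ⊔ 𝒦')|_{V(𝒦')} = e^*((𝓔 ⊔ 𝒦)|_{V(𝒦)})`. [cite: GortzWedhorn2020, Prop. 13.91 (1) and (13.19), p. 413–414]
[OURS · L1 W4.5b] rung TOWER supplier; NOT a statement of the manuscript. -/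
theorem coneRound (hE𝒦 : IsEffectiveCartier (𝓔.comap 𝒦.subschemeι)) (hτ : IsBlowup τ (𝓔 ⊔ 𝒦)) :
    ∃ e : (strictTransformIdeal τ (𝓔 ⊔ 𝒦) 𝒦).subscheme ≅ 𝒦.subscheme,
      e.hom ≫ 𝒦.subschemeι = (strictTransformIdeal τ (𝓔 ⊔ 𝒦) 𝒦).subschemeι ≫ τ ∧
      IsEffectiveCartier (((𝓔 ⊔ 𝒦).comap τ).comap (strictTransformIdeal τ (𝓔 ⊔ 𝒦) 𝒦).subschemeι) ∧
      ((𝓔 ⊔ 𝒦).comap τ ⊔ strictTransformIdeal τ (𝓔 ⊔ 𝒦) 𝒦).comap (strictTransformIdeal τ (𝓔 ⊔ 𝒦) 𝒦).subschemeι =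
        ((𝓔 ⊔ 𝒦).comap 𝒦.subschemeι).comap e.hom := by
  haveI : IsProper τ := hτ.isProper
  haveI : IsLocallyNoetherian X' := LocallyOfFiniteType.isLocallyNoetherian τ
  have hCK : IsEffectiveCartier ((𝓔 ⊔ 𝒦).comap 𝒦.subschemeι) := by
    rw [comap_sup_subschemeι_self]; exact hE𝒦
  obtain ⟨πS, hπS⟩ := exists_hom_subscheme_strictTransformIdeal_of_idealSheaf τ (𝓔 ⊔ 𝒦) 𝒦
  haveI : IsIso πS := isIso_subscheme_strictTransformIdeal_of_isEffectiveCartier hτ hCK πS hπS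
  refine ⟨asIso πS, hπS, Summit.ResolutionOfSingularities.ResolutionOfSingularities.Theorems.SigmaMaxModificationsCorridor3.Helpers.isEffectiveCartier_comap_subschemeι_strictTransformIdeal hτ 𝒦, ?_⟩
  rw [Scheme.IdealSheafData.comap_sup, comap_subschemeι_self, sup_bot_eq, asIso_hom,
    ← Scheme.IdealSheafData.comap_comp (𝓔 ⊔ 𝒦) πS 𝒦.subschemeι, hπS, Scheme.IdealSheafData.comap_comp]

/-- **Clause (1) alone, as data-free `Nonempty`.** [cite: GortzWedhorn2020, (13.19) p. 413] -/
theorem nonempty_iso_subscheme_strictTransformIdeal_cone (hE𝒦 : IsEffectiveCartier (𝓔.comap 𝒦.subschemeι))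
    (hτ : IsBlowup τ (𝓔 ⊔ 𝒦)) :
    ∃ e : (strictTransformIdeal τ (𝓔 ⊔ 𝒦) 𝒦).subscheme ≅ 𝒦.subscheme,
      e.hom ≫ 𝒦.subschemeι = (strictTransformIdeal τ (𝓔 ⊔ 𝒦) 𝒦).subschemeι ≫ τ :=
  (coneRound 𝓔 𝒦 hE𝒦 hτ).imp fun _ h => h.1

/-- **Clause (2) alone: the rounds iterate.** With `𝓔' := (𝓔 ⊔ 𝒦).comap τ` and `𝒦' := strictTransformIdeal τ (𝓔 ⊔ 𝒦) 𝒦`,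
`𝓔'|_{V(𝒦')}` is an effective Cartier divisor, so `coneRound 𝓔' 𝒦'` applies to the next blow-up along `𝓔' ⊔ 𝒦'`.
[cite: GortzWedhorn2020, (13.19) p. 414] -/
theorem isEffectiveCartier_cone_next (hτ : IsBlowup τ (𝓔 ⊔ 𝒦)) :
    IsEffectiveCartier (((𝓔 ⊔ 𝒦).comap τ).comap (strictTransformIdeal τ (𝓔 ⊔ 𝒦) 𝒦).subschemeι) := by
  haveI : IsProper τ := hτ.isProper
  haveI : IsLocallyNoetherian X' := LocallyOfFiniteType.isLocallyNoetherian τ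
  exact Summit.ResolutionOfSingularities.ResolutionOfSingularities.Theorems.SigmaMaxModificationsCorridor3.Helpers.isEffectiveCartier_comap_subschemeι_strictTransformIdeal hτ 𝒦

end ConeRound

end Summit.ResolutionOfSingularities.ResolutionOfSingularities.Cruxes.EquisingularLiftNat.Sections

end
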